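import Summits.QuantumFields.BalabanUV.Beta.CombHId2W2Exchange

/-!
# `BalabanUV.Beta.CombHId2W2Slot` — binder row D1 (OWNER an2), (J-a) dictionary, (C2) at ORDER 2, part TWO-c (letters, end): **`Σ'_n` PASSES INSIDE THE TABLE SLOT OF
# BOTH CHAIN-RULE VERTICES, AND THE FAR BOUNDS OF BOTH VERTICES OVER A FAMILY LOCALISED AWAY FROM THE COLUMN's BOND**

WHY.  In the words of `W2OfK` under the door's copy sum the moving bond sits in the INNER table of a nested vertex (`vertex2OfK`, `mixOfK`): the copies must be summed
inside the outer vertex's slot (§6), which needs the outer family's far bound in `n` (§7) as the majorant's `n`-factor.  Half-triangle majorants throughout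
(`CombHId2W2Letters.exp_half_triangle`).
WHAT ([folklore]; 0 `def`, 0 cited fact, 0 `def … : Prop`, 0 sorry): §6 **`tsum_vertexOfK_slot`**, **`tsum_vertexOfM_slot`** (families with a moving localisation centre `p + M∘n`);
§7 **`abs_vertexOfK_le_of_far`**, **`abs_vertexOfM_le_of_far`**, `biLoc_vertexOfK_of_biLocAt`, `biLoc_vertexOfM_of_biLocAt` (a vertex over a family localised at ONE
common point is localised there); §8 **`dper_tsum_family'`** (C3c's `dper_tsum_family` with MOVING localisation centres `p n` — `summable_prod_of_nonneg`).
NOT HERE: the words (→ `CombHId2W2Words`); nothing of Bałaban's asserted; NOT D1, NEVER «G-an2-4 closed», NOT BetaPertH, NOT continuum, NOT Clay.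

HONEST DEPENDENCY (page 1, mandatory): continuum YM on T⁴ ⇐ BetaPertH ∧ nine spine estimates (0/9 proved); BetaPertH ⇐ (D1) ∧ (D4) ∧ CAP+tail;
G-an2-4 gates asym, D1 and NE2/3/4.  HONEST FRAMING (cell contract, verbatim): «discharging `BetaPertH` makes Bałaban's UV stability UNCONDITIONAL —
a real constructive-QFT result; it is NOT the continuum limit and NOT the Clay problem.»  ABSOLUTE RULE (cell charter, verbatim): «No internally-minted
statement may enter as a cited fact. Every hypothesis is either kernel-proved in this package or a verbatim quotation of a PUBLISHED theorem with page
reference. The manuscript(s) under audit are NOT citable for their own disputed steps — they are the thing under adjudication; programme-internal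
(2001/route/tribunal) claims are never citable.»  Row D1 OWNER an2 (b2b-balaban-beta-an2) gen 44, 2026-08-23; over `CombHId2W2Letters ∕ Exchange`, `KernelWard` BY NAME.
-/

noncomputable section

open scoped BigOperators

namespace Summit.QuantumFields.BalabanUV.Beta.CombHId2W2Slot

open Literature.MathematicalPhysics.QuantumFieldTheory.Balaban1983to89
open Literature.MathematicalPhysics.QuantumFieldTheory.Balaban1983to89.Beta
open B12Sec2to5 (l1 l1_nonneg)
open B4TorusKernel.MultiPeriod (translate translate_apply)
open ExpKernelCalculus (MKer Decays BiLoc VertexFamily comp shiftK summable_exp_shift summable_exp_shift' l1_sub_triangle l1_sub_symm)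
open AffineAveraging (Site)
open OneStepResolventKernel (Fib)
open OneStepKernelFamily (vertexOfK)
open SecondOrderResponse (colM vertexOfM dM dM_apply)
open InterLevelTransport (cwsum cwsum_apply)
open KernelWard (ProdBound tsum_comm_of_prodBound)
open BalabanStepJetsSucc (l1_sub_le_l1_smul_sub)
open Summit.QuantumFields.BalabanUV.Beta.FP.KernelPeriodisationFibLoc (dper dper_apply shiftK_eq_translate summable_exp_l1_translate)
open Summit.QuantumFields.BalabanUV.Beta.CombHId1Letters (vertexOfK_apply)

open Summit.QuantumFields.BalabanUV.Beta.CombHId2W2Letters (exp_rate_mono exp_half_triangle abs_le_row_of_biLoc abs_le_of_decays summable_exp_l1_nsmul_sub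
  summable_exp_l1_sub_nsmul)

variable {d : ℕ} (M : Fin (d + 1) → ℕ) [∀ μ, NeZero (M μ)] {N : ℕ} [NeZero N]

/-! ## §6 `Σ'_n` passes inside the table slot of both vertices (families with a moving localisation centre `p + M∘n`) -/

section Slot

variable {K : MKer (d + 1) (Fib d)} {CK δK C δ : ℝ} {p : Site (d + 1)}

omit [NeZero N] in
/-- [folklore] **`Σ'_n vertexOfK K N (F n) = vertexOfK K N (Σ'_n F n)`** (pointwise) for `K` decaying and a family of tables with `|F n κ u x z a c| ≤ C·e^{−δ|p + M∘n − u|₁}`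
(the `n`-th copy localised at the fine index `p + M∘n`; half-triangle majorant). -/
theorem tsum_vertexOfK_slot {F : Site (d + 1) → Fin (d + 1) → Site (d + 1) → MKer (d + 1) (Fib d)} (hK : Decays K CK δK) (hδK : 0 < δK)
    (hF : ∀ n κ u x z a c, |F n κ u x z a c| ≤ C * Real.exp (-δ * l1 (translate M p n - u))) (hC : 0 ≤ C) (hδ : 0 < δ)
    (μ : Fin (d + 1)) (y x z : Site (d + 1)) (a c : Fib d) :
    ∑' n : Site (d + 1), vertexOfK K N (F n) μ y x z a c = vertexOfK K N (fun κ u => fun x z a c => ∑' n : Site (d + 1), F n κ u x z a c) μ y x z a c := by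
  have hCK : 0 ≤ CK := hK.nonneg (Sum.inl 0)
  set r : ℝ := min δK δ with hr
  have hr0 : 0 < r := lt_min hδK hδ
  have hPB : ∀ κ : Fin (d + 1), ProdBound fun n u => K u ((N : ℤ) • y) (Sum.inl κ) (Sum.inr μ) * F n κ u x z a c := by
    intro κ
    refine ⟨fun n => Real.exp (-(r / 2) * l1 (translate M p n - (N : ℤ) • y)), fun u => CK * C * Real.exp (-(r / 2) * l1 (u - (N : ℤ) • y)),
      (summable_exp_l1_translate M (half_pos hr0) ((N : ℤ) • y) p).1, (summable_exp_shift' (half_pos hr0) ((N : ℤ) • y)).mul_left _,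
      fun n => (Real.exp_pos _).le, fun u => by positivity, fun n u => ?_⟩
    rw [abs_mul]
    have h1 := abs_le_of_decays hK (min_le_left δK δ) u ((N : ℤ) • y) (Sum.inl κ) (Sum.inr μ)
    have h2 : |F n κ u x z a c| ≤ C * Real.exp (-r * l1 (translate M p n - u)) :=
      (hF n κ u x z a c).trans (mul_le_mul_of_nonneg_left (exp_rate_mono (min_le_right δK δ) (l1_nonneg _)) hC)
    calc |K u ((N : ℤ) • y) (Sum.inl κ) (Sum.inr μ)| * |F n κ u x z a c|
        ≤ (CK * Real.exp (-r * l1 (u - (N : ℤ) • y))) * (C * Real.exp (-r * l1 (translate M p n - u))) := mul_le_mul h1 h2 (abs_nonneg _) (by positivity)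
      _ = CK * C * (Real.exp (-r * l1 (u - (N : ℤ) • y)) * Real.exp (-r * l1 (translate M p n - u))) := by ring
      _ ≤ CK * C * (Real.exp (-(r / 2) * l1 (translate M p n - (N : ℤ) • y)) * Real.exp (-(r / 2) * l1 (u - (N : ℤ) • y))) :=
          mul_le_mul_of_nonneg_left (exp_half_triangle hr0.le _ _ _) (by positivity)
      _ = _ := by ring
  have hs : ∀ κ : Fin (d + 1), Summable fun n => ∑' u, K u ((N : ℤ) • y) (Sum.inl κ) (Sum.inr μ) * F n κ u x z a c :=
    fun κ => by obtain ⟨h0, -, -⟩ := (hPB κ).summable; exact h0.prod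
  simp only [vertexOfK_apply]
  rw [Summable.tsum_finsetSum (fun κ _ => hs κ)]
  refine Finset.sum_congr rfl fun κ _ => ?_
  rw [tsum_comm_of_prodBound (hPB κ)]
  refine tsum_congr fun u => ?_
  exact tsum_mul_left

/-- [folklore] **`Σ'_n vertexOfM K N (G n) = vertexOfM K N (Σ'_n G n)`** (pointwise) for `K` decaying and coarse tables with `|G n ρ w x z a c| ≤ C·e^{−δ|p + M∘n − N•w|₁}`. -/
theorem tsum_vertexOfM_slot {G : Site (d + 1) → Fin (d + 1) → Site (d + 1) → MKer (d + 1) (Fib d)} (hK : Decays K CK δK) (hδK : 0 < δK)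
    (hG : ∀ n ρ w x z a c, |G n ρ w x z a c| ≤ C * Real.exp (-δ * l1 (translate M p n - (N : ℤ) • w))) (hC : 0 ≤ C) (hδ : 0 < δ)
    (μ : Fin (d + 1)) (y x z : Site (d + 1)) (a c : Fib d) :
    ∑' n : Site (d + 1), vertexOfM K N (G n) μ y x z a c = vertexOfM K N (fun ρ w => fun x z a c => ∑' n : Site (d + 1), G n ρ w x z a c) μ y x z a c := by
  have hCK : 0 ≤ CK := hK.nonneg (Sum.inl 0)
  have hN : 1 ≤ N := Nat.one_le_iff_ne_zero.mpr (NeZero.ne N)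
  set r : ℝ := min δK δ with hr
  have hr0 : 0 < r := lt_min hδK hδ
  have e : ∀ (F : Fin (d + 1) → Site (d + 1) → MKer (d + 1) (Fib d)),
      vertexOfM K N F μ y x z a c = ∑ ρ, ∑' w, K ((N : ℤ) • w) ((N : ℤ) • y) (Sum.inr ρ) (Sum.inr μ) * F ρ w x z a c :=
    fun F => by simp only [vertexOfM, cwsum_apply, colM]
  have hPB : ∀ ρ : Fin (d + 1), ProdBound fun n w => K ((N : ℤ) • w) ((N : ℤ) • y) (Sum.inr ρ) (Sum.inr μ) * G n ρ w x z a c := by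
    intro ρ
    refine ⟨fun n => Real.exp (-(r / 2) * l1 (translate M p n - (N : ℤ) • y)), fun w => CK * C * Real.exp (-(r / 2) * l1 ((N : ℤ) • w - (N : ℤ) • y)),
      (summable_exp_l1_translate M (half_pos hr0) ((N : ℤ) • y) p).1, (summable_exp_l1_nsmul_sub (N := N) hN (half_pos hr0) ((N : ℤ) • y)).mul_left _,
      fun n => (Real.exp_pos _).le, fun w => by positivity, fun n w => ?_⟩
    rw [abs_mul]
    have h1 := abs_le_of_decays hK (min_le_left δK δ) ((N : ℤ) • w) ((N : ℤ) • y) (Sum.inr ρ) (Sum.inr μ)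
    have h2 : |G n ρ w x z a c| ≤ C * Real.exp (-r * l1 (translate M p n - (N : ℤ) • w)) :=
      (hG n ρ w x z a c).trans (mul_le_mul_of_nonneg_left (exp_rate_mono (min_le_right δK δ) (l1_nonneg _)) hC)
    calc |K ((N : ℤ) • w) ((N : ℤ) • y) (Sum.inr ρ) (Sum.inr μ)| * |G n ρ w x z a c|
        ≤ (CK * Real.exp (-r * l1 ((N : ℤ) • w - (N : ℤ) • y))) * (C * Real.exp (-r * l1 (translate M p n - (N : ℤ) • w))) :=
          mul_le_mul h1 h2 (abs_nonneg _) (by positivity)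
      _ = CK * C * (Real.exp (-r * l1 ((N : ℤ) • w - (N : ℤ) • y)) * Real.exp (-r * l1 (translate M p n - (N : ℤ) • w))) := by ring
      _ ≤ CK * C * (Real.exp (-(r / 2) * l1 (translate M p n - (N : ℤ) • y)) * Real.exp (-(r / 2) * l1 ((N : ℤ) • w - (N : ℤ) • y))) :=
          mul_le_mul_of_nonneg_left (exp_half_triangle hr0.le _ _ _) (by positivity)
      _ = _ := by ring
  have hs : ∀ ρ : Fin (d + 1), Summable fun n => ∑' w, K ((N : ℤ) • w) ((N : ℤ) • y) (Sum.inr ρ) (Sum.inr μ) * G n ρ w x z a c :=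
    fun ρ => by obtain ⟨h0, -, -⟩ := (hPB ρ).summable; exact h0.prod
  simp only [e]
  rw [Summable.tsum_finsetSum (fun ρ _ => hs ρ)]
  refine Finset.sum_congr rfl fun ρ _ => ?_
  rw [tsum_comm_of_prodBound (hPB ρ)]
  refine tsum_congr fun w => ?_
  exact tsum_mul_left

end Slot

/-! ## §7 Crude far bounds of both vertices over a family localised away from the column's bond -/

section Far

variable {K : MKer (d + 1) (Fib d)} {CK δK C δ : ℝ} {q : Site (d + 1)}

omit [NeZero N] in
/-- [folklore] **FAR BOUND OF THE FIELD-COLUMN VERTEX**: if every table entry is `≤ C·e^{−δ|q − u|₁}` (the family is localised near a point `q`, uniformly in the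
kernel arguments), then `|vertexOfK K N F ν y′ x z a c| ≤ (d+1)·(CK·C·Zl(r∕2))·e^{−(r∕2)|q − N•y′|₁}`, `r := min δK δ` (half-triangle + `tsum_exp_shift'`). -/
theorem abs_vertexOfK_le_of_far {F : Fin (d + 1) → Site (d + 1) → MKer (d + 1) (Fib d)} (hK : Decays K CK δK) (hδK : 0 < δK)
    (hF : ∀ κ u x z a c, |F κ u x z a c| ≤ C * Real.exp (-δ * l1 (q - u))) (hC : 0 ≤ C) (hδ : 0 < δ)
    (ν : Fin (d + 1)) (y' x z : Site (d + 1)) (a c : Fib d) :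
    |vertexOfK K N F ν y' x z a c|
      ≤ (d + 1 : ℕ) * (CK * C * ExpKernelCalculus.Zl (d + 1) (min δK δ / 2)) * Real.exp (-(min δK δ / 2) * l1 (q - (N : ℤ) • y')) := by
  have hCK : 0 ≤ CK := hK.nonneg (Sum.inl 0)
  set r : ℝ := min δK δ with hr
  have hr0 : 0 < r := lt_min hδK hδ
  have hterm : ∀ (κ : Fin (d + 1)) (u : Site (d + 1)), |K u ((N : ℤ) • y') (Sum.inl κ) (Sum.inr ν) * F κ u x z a c|
      ≤ CK * C * Real.exp (-(r / 2) * l1 (q - (N : ℤ) • y')) * Real.exp (-(r / 2) * l1 (u - (N : ℤ) • y')) := by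
    intro κ u
    rw [abs_mul]
    have h1 := abs_le_of_decays hK (min_le_left δK δ) u ((N : ℤ) • y') (Sum.inl κ) (Sum.inr ν)
    have h2 : |F κ u x z a c| ≤ C * Real.exp (-r * l1 (q - u)) :=
      (hF κ u x z a c).trans (mul_le_mul_of_nonneg_left (exp_rate_mono (min_le_right δK δ) (l1_nonneg _)) hC)
    calc |K u ((N : ℤ) • y') (Sum.inl κ) (Sum.inr ν)| * |F κ u x z a c| ≤ (CK * Real.exp (-r * l1 (u - (N : ℤ) • y'))) * (C * Real.exp (-r * l1 (q - u))) :=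
          mul_le_mul h1 h2 (abs_nonneg _) (by positivity)
      _ = CK * C * (Real.exp (-r * l1 (u - (N : ℤ) • y')) * Real.exp (-r * l1 (q - u))) := by ring
      _ ≤ CK * C * (Real.exp (-(r / 2) * l1 (q - (N : ℤ) • y')) * Real.exp (-(r / 2) * l1 (u - (N : ℤ) • y'))) :=
          mul_le_mul_of_nonneg_left (exp_half_triangle hr0.le _ _ _) (by positivity)
      _ = _ := by ring
  have hs := summable_exp_shift' (half_pos hr0) ((N : ℤ) • y')
  have hκ : ∀ κ : Fin (d + 1), |∑' u, K u ((N : ℤ) • y') (Sum.inl κ) (Sum.inr ν) * F κ u x z a c|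
      ≤ CK * C * ExpKernelCalculus.Zl (d + 1) (r / 2) * Real.exp (-(r / 2) * l1 (q - (N : ℤ) • y')) := by
    intro κ
    have h := tsum_of_norm_bounded ((hs.mul_left (CK * C * Real.exp (-(r / 2) * l1 (q - (N : ℤ) • y')))).hasSum)
      fun u => by rw [Real.norm_eq_abs]; exact hterm κ u
    rw [Real.norm_eq_abs, tsum_mul_left, ExpKernelCalculus.tsum_exp_shift'] at h
    refine h.trans (le_of_eq ?_)
    ring
  rw [vertexOfK_apply]
  calc |∑ κ : Fin (d + 1), ∑' u, K u ((N : ℤ) • y') (Sum.inl κ) (Sum.inr ν) * F κ u x z a c|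
      ≤ ∑ κ : Fin (d + 1), |∑' u, K u ((N : ℤ) • y') (Sum.inl κ) (Sum.inr ν) * F κ u x z a c| := Finset.abs_sum_le_sum_abs _ _
    _ ≤ ∑ _κ : Fin (d + 1), CK * C * ExpKernelCalculus.Zl (d + 1) (r / 2) * Real.exp (-(r / 2) * l1 (q - (N : ℤ) • y')) := Finset.sum_le_sum fun κ _ => hκ κ
    _ = _ := by rw [Finset.sum_const, Finset.card_univ, Fintype.card_fin, nsmul_eq_mul]; ring

/-- [folklore] **FAR BOUND OF THE MULTIPLIER-COLUMN VERTEX**: if every coarse table entry is `≤ C·e^{−δ|q − N•w|₁}`, then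
`|vertexOfM K N G ν y′ x z a c| ≤ (d+1)·(CK·C·Z)·e^{−(r∕2)|q − N•y′|₁}` with `Z := Σ'_w e^{−(r∕2)|N•w − N•y′|₁}`, `r := min δK δ`. -/
theorem abs_vertexOfM_le_of_far {G : Fin (d + 1) → Site (d + 1) → MKer (d + 1) (Fib d)} (hK : Decays K CK δK) (hδK : 0 < δK)
    (hG : ∀ ρ w x z a c, |G ρ w x z a c| ≤ C * Real.exp (-δ * l1 (q - (N : ℤ) • w))) (hC : 0 ≤ C) (hδ : 0 < δ)
    (ν : Fin (d + 1)) (y' x z : Site (d + 1)) (a c : Fib d) :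
    |vertexOfM K N G ν y' x z a c|
      ≤ (d + 1 : ℕ) * (CK * C * ∑' w : Site (d + 1), Real.exp (-(min δK δ / 2) * l1 ((N : ℤ) • w - (N : ℤ) • y')))
          * Real.exp (-(min δK δ / 2) * l1 (q - (N : ℤ) • y')) := by
  have hCK : 0 ≤ CK := hK.nonneg (Sum.inl 0)
  have hN : 1 ≤ N := Nat.one_le_iff_ne_zero.mpr (NeZero.ne N)
  set r : ℝ := min δK δ with hr
  have hr0 : 0 < r := lt_min hδK hδ
  have hterm : ∀ (ρ : Fin (d + 1)) (w : Site (d + 1)), |K ((N : ℤ) • w) ((N : ℤ) • y') (Sum.inr ρ) (Sum.inr ν) * G ρ w x z a c|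
      ≤ CK * C * Real.exp (-(r / 2) * l1 (q - (N : ℤ) • y')) * Real.exp (-(r / 2) * l1 ((N : ℤ) • w - (N : ℤ) • y')) := by
    intro ρ w
    rw [abs_mul]
    have h1 := abs_le_of_decays hK (min_le_left δK δ) ((N : ℤ) • w) ((N : ℤ) • y') (Sum.inr ρ) (Sum.inr ν)
    have h2 : |G ρ w x z a c| ≤ C * Real.exp (-r * l1 (q - (N : ℤ) • w)) :=
      (hG ρ w x z a c).trans (mul_le_mul_of_nonneg_left (exp_rate_mono (min_le_right δK δ) (l1_nonneg _)) hC)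
    calc |K ((N : ℤ) • w) ((N : ℤ) • y') (Sum.inr ρ) (Sum.inr ν)| * |G ρ w x z a c|
        ≤ (CK * Real.exp (-r * l1 ((N : ℤ) • w - (N : ℤ) • y'))) * (C * Real.exp (-r * l1 (q - (N : ℤ) • w))) := mul_le_mul h1 h2 (abs_nonneg _) (by positivity)
      _ = CK * C * (Real.exp (-r * l1 ((N : ℤ) • w - (N : ℤ) • y')) * Real.exp (-r * l1 (q - (N : ℤ) • w))) := by ring
      _ ≤ CK * C * (Real.exp (-(r / 2) * l1 (q - (N : ℤ) • y')) * Real.exp (-(r / 2) * l1 ((N : ℤ) • w - (N : ℤ) • y'))) :=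
          mul_le_mul_of_nonneg_left (exp_half_triangle hr0.le _ _ _) (by positivity)
      _ = _ := by ring
  have hs := summable_exp_l1_nsmul_sub (N := N) hN (half_pos hr0) ((N : ℤ) • y')
  have hρ : ∀ ρ : Fin (d + 1), |∑' w, K ((N : ℤ) • w) ((N : ℤ) • y') (Sum.inr ρ) (Sum.inr ν) * G ρ w x z a c|
      ≤ CK * C * (∑' w : Site (d + 1), Real.exp (-(r / 2) * l1 ((N : ℤ) • w - (N : ℤ) • y'))) * Real.exp (-(r / 2) * l1 (q - (N : ℤ) • y')) := by
    intro ρ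
    have h := tsum_of_norm_bounded ((hs.mul_left (CK * C * Real.exp (-(r / 2) * l1 (q - (N : ℤ) • y')))).hasSum)
      fun w => by rw [Real.norm_eq_abs]; exact hterm ρ w
    rw [Real.norm_eq_abs, tsum_mul_left] at h
    refine h.trans (le_of_eq ?_)
    ring
  have e : vertexOfM K N G ν y' x z a c = ∑ ρ, ∑' w, K ((N : ℤ) • w) ((N : ℤ) • y') (Sum.inr ρ) (Sum.inr ν) * G ρ w x z a c := by
    simp only [vertexOfM, cwsum_apply, colM]
  rw [e]
  calc |∑ ρ : Fin (d + 1), ∑' w, K ((N : ℤ) • w) ((N : ℤ) • y') (Sum.inr ρ) (Sum.inr ν) * G ρ w x z a c|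
      ≤ ∑ ρ : Fin (d + 1), |∑' w, K ((N : ℤ) • w) ((N : ℤ) • y') (Sum.inr ρ) (Sum.inr ν) * G ρ w x z a c| := Finset.abs_sum_le_sum_abs _ _
    _ ≤ ∑ _ρ : Fin (d + 1), CK * C * (∑' w : Site (d + 1), Real.exp (-(r / 2) * l1 ((N : ℤ) • w - (N : ℤ) • y'))) * Real.exp (-(r / 2) * l1 (q - (N : ℤ) • y')) :=
        Finset.sum_le_sum fun ρ _ => hρ ρ
    _ = _ := by rw [Finset.sum_const, Finset.card_univ, Fintype.card_fin, nsmul_eq_mul]; ring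

omit [NeZero N] in
/-- [folklore] **A FIELD-COLUMN VERTEX OVER A FAMILY LOCALISED AT ONE COMMON POINT IS LOCALISED THERE**: `BiLoc (T κ u) q q B δ` for all `κ u` ⇒
`BiLoc (vertexOfK K N T ν y′) q q ((d+1)·(CK·Zl δK)·B) δ` (the column is absolutely summable: `tsum_exp_shift'`). -/
theorem biLoc_vertexOfK_of_biLocAt {T : Fin (d + 1) → Site (d + 1) → MKer (d + 1) (Fib d)} {B : ℝ} (hK : Decays K CK δK) (hδK : 0 < δK)
    (hT : ∀ κ u, BiLoc (T κ u) q q B δ) (ν : Fin (d + 1)) (y' : Site (d + 1)) :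
    BiLoc (vertexOfK K N T ν y') q q ((d + 1 : ℕ) * (CK * ExpKernelCalculus.Zl (d + 1) δK) * B) δ := by
  have hCK : 0 ≤ CK := hK.nonneg (Sum.inl 0)
  have hB : 0 ≤ B := (hT 0 0).nonneg (Sum.inl 0)
  intro x z a c
  have hs := summable_exp_shift' hδK ((N : ℤ) • y')
  have hκ : ∀ κ : Fin (d + 1), |∑' u, K u ((N : ℤ) • y') (Sum.inl κ) (Sum.inr ν) * T κ u x z a c|
      ≤ CK * ExpKernelCalculus.Zl (d + 1) δK * (B * Real.exp (-δ * (l1 (x - q) + l1 (z - q)))) := by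
    intro κ
    have h := tsum_of_norm_bounded (f := fun u => K u ((N : ℤ) • y') (Sum.inl κ) (Sum.inr ν) * T κ u x z a c)
      ((hs.mul_left CK).mul_right (B * Real.exp (-δ * (l1 (x - q) + l1 (z - q))))).hasSum fun u => by
        rw [Real.norm_eq_abs, abs_mul]
        exact mul_le_mul (hK u _ (Sum.inl κ) (Sum.inr ν)) (hT κ u x z a c) (abs_nonneg _) (by positivity)
    rw [Real.norm_eq_abs, tsum_mul_right, tsum_mul_left, ExpKernelCalculus.tsum_exp_shift'] at h
    exact h
  rw [vertexOfK_apply]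
  calc |∑ κ : Fin (d + 1), ∑' u, K u ((N : ℤ) • y') (Sum.inl κ) (Sum.inr ν) * T κ u x z a c|
      ≤ ∑ κ : Fin (d + 1), |∑' u, K u ((N : ℤ) • y') (Sum.inl κ) (Sum.inr ν) * T κ u x z a c| := Finset.abs_sum_le_sum_abs _ _
    _ ≤ ∑ _κ : Fin (d + 1), CK * ExpKernelCalculus.Zl (d + 1) δK * (B * Real.exp (-δ * (l1 (x - q) + l1 (z - q)))) := Finset.sum_le_sum fun κ _ => hκ κ
    _ = _ := by rw [Finset.sum_const, Finset.card_univ, Fintype.card_fin, nsmul_eq_mul]; ring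

/-- [folklore] **A MULTIPLIER-COLUMN VERTEX OVER A FAMILY LOCALISED AT ONE COMMON POINT IS LOCALISED THERE**:
`BiLoc (vertexOfM K N G ν y′) q q ((d+1)·(CK·Σ'_w e^{−δK|N•w − N•y′|₁})·B) δ`. -/
theorem biLoc_vertexOfM_of_biLocAt {G : Fin (d + 1) → Site (d + 1) → MKer (d + 1) (Fib d)} {B : ℝ} (hK : Decays K CK δK) (hδK : 0 < δK)
    (hG : ∀ ρ w, BiLoc (G ρ w) q q B δ) (ν : Fin (d + 1)) (y' : Site (d + 1)) :
    BiLoc (vertexOfM K N G ν y') q q ((d + 1 : ℕ) * (CK * ∑' w : Site (d + 1), Real.exp (-δK * l1 ((N : ℤ) • w - (N : ℤ) • y'))) * B) δ := by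
  have hCK : 0 ≤ CK := hK.nonneg (Sum.inl 0)
  have hB : 0 ≤ B := (hG 0 0).nonneg (Sum.inl 0)
  have hN : 1 ≤ N := Nat.one_le_iff_ne_zero.mpr (NeZero.ne N)
  intro x z a c
  have hs := summable_exp_l1_nsmul_sub (N := N) hN hδK ((N : ℤ) • y')
  have hZ : 0 ≤ ∑' w : Site (d + 1), Real.exp (-δK * l1 ((N : ℤ) • w - (N : ℤ) • y')) := tsum_nonneg fun w => (Real.exp_pos _).le
  have hρ : ∀ ρ : Fin (d + 1), |∑' w, K ((N : ℤ) • w) ((N : ℤ) • y') (Sum.inr ρ) (Sum.inr ν) * G ρ w x z a c|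
      ≤ CK * (∑' w : Site (d + 1), Real.exp (-δK * l1 ((N : ℤ) • w - (N : ℤ) • y'))) * (B * Real.exp (-δ * (l1 (x - q) + l1 (z - q)))) := by
    intro ρ
    have h := tsum_of_norm_bounded (f := fun w => K ((N : ℤ) • w) ((N : ℤ) • y') (Sum.inr ρ) (Sum.inr ν) * G ρ w x z a c)
      ((hs.mul_left CK).mul_right (B * Real.exp (-δ * (l1 (x - q) + l1 (z - q))))).hasSum fun w => by
        rw [Real.norm_eq_abs, abs_mul]
        exact mul_le_mul (hK _ _ (Sum.inr ρ) (Sum.inr ν)) (hG ρ w x z a c) (abs_nonneg _) (by positivity)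
    rw [Real.norm_eq_abs, tsum_mul_right, tsum_mul_left] at h
    exact h
  have e : vertexOfM K N G ν y' x z a c = ∑ ρ, ∑' w, K ((N : ℤ) • w) ((N : ℤ) • y') (Sum.inr ρ) (Sum.inr ν) * G ρ w x z a c := by
    simp only [vertexOfM, cwsum_apply, colM]
  rw [e]
  calc |∑ ρ : Fin (d + 1), ∑' w, K ((N : ℤ) • w) ((N : ℤ) • y') (Sum.inr ρ) (Sum.inr ν) * G ρ w x z a c|
      ≤ ∑ ρ : Fin (d + 1), |∑' w, K ((N : ℤ) • w) ((N : ℤ) • y') (Sum.inr ρ) (Sum.inr ν) * G ρ w x z a c| := Finset.abs_sum_le_sum_abs _ _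
    _ ≤ ∑ _ρ : Fin (d + 1), CK * (∑' w : Site (d + 1), Real.exp (-δK * l1 ((N : ℤ) • w - (N : ℤ) • y'))) * (B * Real.exp (-δ * (l1 (x - q) + l1 (z - q)))) :=
        Finset.sum_le_sum fun ρ _ => hρ ρ
    _ = _ := by rw [Finset.sum_const, Finset.card_univ, Fintype.card_fin, nsmul_eq_mul]; ring

end Far

/-! ## §8 `dper` through a copy sum with MOVING localisation centres -/

section Moving

omit [NeZero N]

/-- [folklore] **`dper M (x z ↦ Σ'_n T n x z) = Σ'_n dper M (T n)`** (pointwise) for a family with `|T n x z a b| ≤ g n·e^{−δ(|x − p n|₁+|z − p n|₁)}`, `g ≥ 0` summable, the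
centres `p n` ARBITRARY (the bound on `Σ_m e^{−δ|x+M∘m − p n|₁}` is uniform in the centre: `K_{d+1}(δ)`); `summable_prod_of_nonneg` for the double family. -/
theorem dper_tsum_family' {T : Site (d + 1) → MKer (d + 1) (Fib d)} {p : Site (d + 1) → Site (d + 1)} {g : Site (d + 1) → ℝ} {δ : ℝ}
    (hT : ∀ n x z a b, |T n x z a b| ≤ g n * Real.exp (-δ * (l1 (x - p n) + l1 (z - p n)))) (hg : Summable g) (hg0 : ∀ n, 0 ≤ g n)
    (hδ : 0 < δ) (x z : Site (d + 1)) (a b : Fib d) :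
    dper M (fun x z a b => ∑' n, T n x z a b) x z a b = ∑' n, dper M (T n) x z a b ∧ Summable fun n => dper M (T n) x z a b := by
  -- the nonnegative majorant `G (n, m) := g n · e^{−δ|x+M∘m − p n|₁}` is summable on the product
  have hGs : Summable fun nm : Site (d + 1) × Site (d + 1) => g nm.1 * Real.exp (-δ * l1 (translate M x nm.2 - p nm.1)) := by
    refine (summable_prod_of_nonneg fun nm => by exact mul_nonneg (hg0 nm.1) (Real.exp_pos _).le).2 ⟨fun n => ?_, ?_⟩
    · exact ((summable_exp_l1_translate M hδ (p n) x).1).mul_left (g n)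
    · refine Summable.of_nonneg_of_le (fun n => tsum_nonneg fun m => mul_nonneg (hg0 n) (Real.exp_pos _).le)
        (fun n => ?_) (hg.mul_right (B4Sect5Proof.latticeConst (d + 1) δ))
      dsimp only
      rw [tsum_mul_left]
      exact mul_le_mul_of_nonneg_left (summable_exp_l1_translate M hδ (p n) x).2 (hg0 n)
  have hF : Summable fun nm : Site (d + 1) × Site (d + 1) => T nm.1 (translate M x nm.2) (translate M z nm.2) a b := by
    refine Summable.of_norm_bounded hGs fun nm => ?_
    rw [Real.norm_eq_abs]
    refine (hT nm.1 _ _ a b).trans ?_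
    rw [mul_add, Real.exp_add]
    have h1 : Real.exp (-δ * l1 (translate M z nm.2 - p nm.1)) ≤ 1 := by
      rw [Real.exp_le_one_iff]; exact mul_nonpos_of_nonpos_of_nonneg (neg_nonpos.2 hδ.le) (l1_nonneg _)
    calc g nm.1 * (Real.exp (-δ * l1 (translate M x nm.2 - p nm.1)) * Real.exp (-δ * l1 (translate M z nm.2 - p nm.1)))
        ≤ g nm.1 * (Real.exp (-δ * l1 (translate M x nm.2 - p nm.1)) * 1) :=
          mul_le_mul_of_nonneg_left (mul_le_mul_of_nonneg_left h1 (Real.exp_pos _).le) (hg0 _)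
      _ = _ := by rw [mul_one]
  have hF' : Summable (Function.uncurry fun (n m : Site (d + 1)) => T n (translate M x m) (translate M z m) a b) :=
    hF.congr fun nm => by obtain ⟨n, m⟩ := nm; rfl
  refine ⟨?_, ?_⟩
  · simp only [dper_apply]
    exact hF'.tsum_comm
  · simp only [dper_apply]
    exact hF'.prod

end Moving

end Summit.QuantumFields.BalabanUV.Beta.CombHId2W2Slot

end
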